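import Summits.BirchSwinnertonDyer.BirchSwinnertonDyer.Theorems.EisensteinPrimesX2AnalyticLambdaCertificate
import Summits.BirchSwinnertonDyer.Rank1Residual.X2.LambdaParity
import Summits.BirchSwinnertonDyer.Rank1Residual.Iwasawa.RankGrowthLayerHolds
import HarnessLib

/-!
# Route `EisensteinPrimes`, line `mudescent`, crux 3 `MazurMCOnCellB`: stubs 3 + 4 AT A PAIR from one
# unit-coefficient certificate, and the END-TO-END per-pair main-conjecture certificate at a type-A
# split étale end (helper; closes nothing)

Seat `bsd-eis-lam-a` g3 (PROGRAMME PART 1b, ACCEL-LIST (4); items stmt-BirchSwinnertonDyer-19033 /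
-19035; skeleton owner bsd-eis-ky). Sequel of `EisensteinPrimesX2AnalyticLambdaCertificate` (this
seat: certificates ⇒ `X2.AnalyticMuLE W p 0 ∧ X2.AnalyticLambdaEq W p n`) and of lam-b g2's
`EisensteinPrimesX2AlgebraicLambdaGESplitTorsion` (p480562: at a split multiplicative odd `p` with
`p ∣ #E(ℚ)_tors`, `S` places `v ∤ p` with `p ∣ c_v`, and `X2.AnalyticMuLE W p m`:
`AlgebraicLambdaGE W p (b − m)` for `b + 2·v_p(#E(ℚ)_tors) ≤ #S + 1`).

HONEST FRAMING. THEOREMS ONLY — no definition, no new named fact; nothing about any particular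
curve is asserted (the unit-coefficient certificate `Iwasawa.UnitCoeffAt W₀ p m` and the integers are
hypotheses an instrument's exact symbol table / Tamagawa table is EVIDENCE for); closes nothing; moves
no label. Named facts are exactly those already displayed by route T and lam-b: Wuthrich 2014 Thm. 16
(`hWu`), Poitou–Tate over `ℚ` (`hPT`), Greenberg LNM 1716 Prop. 4.15 (ii) (`h415`), modularity
(`hpar`), and for the slack form Greenberg Prop. 3.10 (`h310`) + Gross–Zagier–Kolyvagin (`hGZK`); for
the ascent the `PublishedInputs` conjuncts of `MazurMCOnCellB_of`.

* §1 `lambdaCount_of_unitCoeffAt_of_algebraicLambdaGE`: `UnitCoeffAt W₀ p m`, `AlgebraicLambdaGE W₀ p k`,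
  `m ≤ k` ⇒ `X2.AnalyticMuLE W₀ p 0` (stub 3's conclusion at `W₀`) AND the registered conclusion of
  `stub_lambdaCount_offLocus` at `W₀` VERBATIM (`∃ n k, AnalyticLambdaEq ∧ AlgebraicLambdaGE ∧
  (¬split → n ≤ k) ∧ (split → n ≤ k + 1)`); `mazurMainConjectureAt_of_unitCoeffAt_of_algebraicLambdaGE`
  (route T `X2.mazurMainConjectureAt_of_algebraicLambdaGE`); SLACK form `m ≤ k + 1` with parity
  (`…_of_le`, tree `X2.mazurMainConjectureAt_of_algebraicLambdaGE_of_le`; lam-a g2 p472446); and the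
  RANK-GROWTH road at a REDUCIBLE pair (`…_of_layerRankGEAt`: `UnitCoeffAt W₀ p m'` + iw-1's
  `LayerRankGEAt W₀ p k m`, `m' ≤ m` ⇒ MC; Greenberg Thm. 1.9 binder-free, tree
  `Iwasawa.algebraicLambdaGE_of_layerRankGEAt'` — the tree's `X2_mazurMainConjectureAt_of_layerRankGEAt'`
  wanted the two typed analytic inputs separately; iw-1's `mazurMainConjectureAt_of_unitCoeffAt_of_layerRankGEAt`
  is the IRREDUCIBLE/surjective-image version). This is the road that closed 5946a1@3 / 9294d1@3
  (b2b X2-RESIDUE-p3 GEN 17 fold) and reads MEMO-2 §4b's torsion-point zeros on the algebraic side.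
* §2 END-TO-END at a type-A SPLIT ÉTALE END — the per-pair certificate of lam-b's HANDOFF list with
  its analytic item supplied: `p` odd multiplicative, `p ∣ #E(ℚ)_tors(W₀)` (so split, `E[p]` reducible),
  `S` places `v ∤ p` with `p ∣ c_v(W₀)`, ONE unit coefficient `UnitCoeffAt W₀ p m` (index `m + 1` of
  `ϖ·L_p`), and `m + 2·v_p(#E(ℚ)_tors) ≤ #S + 1` ⇒ `X2.MazurMainConjectureAt W₀ p`
  (`X2.mazurMainConjectureAt_of_unitCoeffAt_of_dvd_torsionOrder_of_dvd_localTamagawaNumber`); slack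
  form `≤ #S + 2` (`…_slack`); and Mazur's main conjecture at EVERY member of the sub-cell X2b class of
  `W₀` (`X2.cellB_mazurMainConjectureAt_of_isIsogenous_etaleEnd_certificate`: the ASCEND step of
  `MazurMCOnCellB_of`). Per pair the line `mudescent` thus closes from: one unit-coefficient index at
  the étale end, `v_p(#E(ℚ)_tors(W₀))`, and `#S` — the kernel form of Greenberg's Cor. 5.6 examples
  (LNM 1716 §5) on type-A split rows, modulo named print.

* §3 (appended) the δ = 0 roads (NO rational `p`-torsion at the member — e.g. the NON-SPLIT type-A étale
  ends of row A10, `φ` a non-trivial even character): `UnitCoeffAt W p m` + lam-b's layer-0 Tamagawa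
  budget (p469158 `X2.algebraicLambdaGE_of_dvd_localTamagawaNumber`: `S` places `v ∤ p` with `p ∣ c_v`,
  `p ∤ #E(ℚ)_tors`) with `m ≤ #S` ⇒ MC (`…_of_dvd_localTamagawaNumber`); and the TOWER count (p469158
  `X2.algebraicLambdaGE_layer_of_certificates`: place-count certificates `v_p(N(v)^{p−1} − 1) = m_v + 1`,
  `m ≤ Σ_{v∈S} p^{min(n, m_v)}`) ⇒ MC (`…_of_layer_certificates`).

References: [GreenbergLNM1716] §5 pp. 114–118, Cor. 5.6 (p. 136), Prop. 3.10, Prop. 4.14, Prop. 4.15 (ii);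
[GreenbergVatsal2000] (1)–(2), p. 28; [Wuthrich2014] Thm. 16; [MazurTateTeitelbaum1986Invent] §I.15;
HOME/HANDOFF.md § bsd-eis-lam-b g2 ("WHAT A CERTIFICATE NOW NEEDS"); HOME/lam-a-g2/lam-a-MEMO-2.md §1.
-/

set_option linter.dupNamespace false
set_option autoImplicit false

noncomputable section

open scoped Classical MatrixGroups ModularForm

open PowerSeries CongruenceSubgroup WeierstrassCurve NumberField IsDedekindDomain
  Literature.NumberTheory.EllipticCurves
  Literature.NumberTheory.EllipticCurves.ModularForms
  Literature.NumberTheory.EllipticCurves.Rank1Residual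
  Literature.NumberTheory.EllipticCurves.Greenberg1999
  Literature.NumberTheory.EllipticCurves.Wuthrich2014
  Literature.NumberTheory.EllipticCurves.SteinWuthrich2013
  Literature.NumberTheory.GaloisCohomology
  Summit.BirchSwinnertonDyer.Rank1Residual
  Summit.BirchSwinnertonDyer.Rank1Residual.X1.MuLambda
  Summit.BirchSwinnertonDyer.Rank1Residual.X1.TamagawaSqueeze
  Summit.BirchSwinnertonDyer.Rank1Residual.Iwasawa
  Summit.BirchSwinnertonDyer.BirchSwinnertonDyer.Theorems.EisensteinPrimesX2AnalyticLambdaCertificate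
  Summit.BirchSwinnertonDyer.BirchSwinnertonDyer.Theorems.EisensteinPrimesX2AlgebraicLambdaGESplitTorsion

namespace Summit.BirchSwinnertonDyer.BirchSwinnertonDyer.Theorems.EisensteinPrimesX2LambdaCountAtPair

variable {W : WeierstrassCurve ℚ} [W.IsElliptic] [W.IsGloballyMinimal] {p : ℕ} [hp : Fact p.Prime]

/-! ## §1. Stubs 3 + 4 at a pair from one unit-coefficient certificate and an algebraic budget -/

/-- **Stubs 3 and 4 of `mudescent` AT A PAIR, from certificates.** `UnitCoeffAt W₀ p m` (the
coefficient of index `m + e` of `ϖ·L_p(W₀,T)` is a unit), `AlgebraicLambdaGE W₀ p k` and `m ≤ k` give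
`X2.AnalyticMuLE W₀ p 0` and the registered conclusion of `stub_lambdaCount_offLocus` at `W₀` verbatim
(`n := λ_an ≤ m + e`). [cite: GreenbergVatsal2000, p. 2–3, (1)–(2)] [cite: GreenbergLNM1716, Cor. 5.6 (p. 136)] -/
theorem lambdaCount_of_unitCoeffAt_of_algebraicLambdaGE {m k : ℕ} (hcert : UnitCoeffAt W p m)
    (halg : AlgebraicLambdaGE W p k) (hmk : m ≤ k) :
    X2.AnalyticMuLE W p 0 ∧
      ∃ n k : ℕ, X2.AnalyticLambdaEq W p n ∧ AlgebraicLambdaGE W p k ∧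
        (¬ W.HasSplitMultiplicativeReductionAtPrime p → n ≤ k) ∧
        (W.HasSplitMultiplicativeReductionAtPrime p → n ≤ k + 1) := by
  obtain ⟨hμ, n, hn, hN, hS⟩ := analyticMuLE_zero_and_exists_analyticLambdaEq_of_unitCoeffAt hcert
  exact ⟨hμ, n, k, hn, halg, fun h ↦ (hN h).trans hmk, fun h ↦ (hS h).trans (by omega)⟩

/-- **Mazur's main conjecture AT A PAIR from certificates** (reducible `E[p]`, odd multiplicative `p`):
`UnitCoeffAt W₀ p m` + `AlgebraicLambdaGE W₀ p k` + `m ≤ k` ⇒ `X2.MazurMainConjectureAt W₀ p`, by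
route T at `p ‖ N` (`X2.mazurMainConjectureAt_of_algebraicLambdaGE`, Wuthrich 2014 Thm. 16 `hWu`).
[cite: Wuthrich2014, Thm. 16 (p. 397)] [cite: GreenbergVatsal2000, p. 4 (after Thm. (1.2))] -/
theorem mazurMainConjectureAt_of_unitCoeffAt_of_algebraicLambdaGE
    (hWu : thm16_charIdeal_dvd_multiplicative_of_reducible) (hp2 : p ≠ 2)
    (hmult : W.HasMultiplicativeReductionAtPrime p) (hred : ¬ W.HasIrreducibleModPGaloisRep p)
    {m k : ℕ} (hcert : UnitCoeffAt W p m) (halg : AlgebraicLambdaGE W p k) (hmk : m ≤ k) :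
    X2.MazurMainConjectureAt W p := by
  obtain ⟨hμ, n, k', hn, halg', hN, hS⟩ :=
    lambdaCount_of_unitCoeffAt_of_algebraicLambdaGE hcert halg hmk
  exact X2.mazurMainConjectureAt_of_algebraicLambdaGE hWu W p hp2 hmult hred hμ hn halg' hN hS

/-- **Slack form** (one algebraic zero fewer: `m ≤ k + 1`), analytic rank `≤ 1`: the parity theorem
`λ_an ≡ r_an + e (mod 2)` (tree, MTT functional equation) with Greenberg Prop. 3.10 (`h310`) and
Gross–Zagier–Kolyvagin (`hGZK`), tree `X2.mazurMainConjectureAt_of_algebraicLambdaGE_of_le`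
(lam-a g2, `EisensteinPrimesLambdaCountParitySlack`). [cite: GreenbergLNM1716, Prop. 3.10]
[cite: Wuthrich2014, Thm. 16 (p. 397)] -/
theorem mazurMainConjectureAt_of_unitCoeffAt_of_algebraicLambdaGE_of_le
    (hWu : thm16_charIdeal_dvd_multiplicative_of_reducible)
    (h310 : prop310_selmerCorank_mod_two_eq_lambdaInvariant)
    (hGZK : rank_eq_analyticRank_of_analyticRank_le_one)
    (hpar : nonempty_modularParametrizationData) (hp2 : p ≠ 2)
    (hmult : W.HasMultiplicativeReductionAtPrime p) (hred : ¬ W.HasIrreducibleModPGaloisRep p)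
    (hr : W.analyticRank ≤ 1) {m k : ℕ} (hcert : UnitCoeffAt W p m) (halg : AlgebraicLambdaGE W p k)
    (hmk : m ≤ k + 1) : X2.MazurMainConjectureAt W p := by
  obtain ⟨hμ, n, hn, hN, hS⟩ := analyticMuLE_zero_and_exists_analyticLambdaEq_of_unitCoeffAt hcert
  exact X2.mazurMainConjectureAt_of_algebraicLambdaGE_of_le hWu h310 hGZK hpar W p hp2 hmult hred hr hμ
    hn halg (fun h ↦ (hN h).trans hmk) (fun h ↦ (hS h).trans (by omega))

/-- **REDUCIBLE X2 pair, RANK-GROWTH road**: `UnitCoeffAt W₀ p m'` (census), a rank-growth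
certificate `LayerRankGEAt W₀ p k m` (`rank E(ℚ_k) ≥ m`: iw-1's exact points over `ℚ(ζ_9)⁺`, two
engines) and `m' ≤ m` ⇒ `X2.MazurMainConjectureAt W₀ p` — Greenberg's Thm. 1.9 (PROVED, A158;
binder-free `Iwasawa.algebraicLambdaGE_of_layerRankGEAt'`) + route T. The algebraic face of the
torsion-point zeros of `L_p(E₀,T)` (this seat's `totient_le_of_analyticLambdaEq_of_twist_eq_zero`).
[cite: GreenbergLNM1716, Thm. 1.9 (p. 63)] [cite: Wuthrich2014, Thm. 16 (p. 397)] -/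
theorem mazurMainConjectureAt_of_unitCoeffAt_of_layerRankGEAt
    (hWu : thm16_charIdeal_dvd_multiplicative_of_reducible) (hp2 : p ≠ 2)
    (hmult : W.HasMultiplicativeReductionAtPrime p) (hred : ¬ W.HasIrreducibleModPGaloisRep p)
    {m' k m : ℕ} (hcert : UnitCoeffAt W p m') (hm : LayerRankGEAt W p k m) (hle : m' ≤ m) :
    X2.MazurMainConjectureAt W p :=
  mazurMainConjectureAt_of_unitCoeffAt_of_algebraicLambdaGE hWu hp2 hmult hred hcert
    (algebraicLambdaGE_of_layerRankGEAt' (Or.inr hmult) hm) hle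

/-- **Rank-growth road, slack form** (`m' ≤ m + 1`, analytic rank `≤ 1`, parity `h310` + `hGZK`): a
`+2` certificate at the first layer now reaches `λ_an ≤ e + 3`, a `+4` (double zero) `λ_an ≤ e + 5`.
[cite: GreenbergLNM1716, Thm. 1.9 (p. 63) and Prop. 3.10] [cite: Wuthrich2014, Thm. 16 (p. 397)] -/
theorem mazurMainConjectureAt_of_unitCoeffAt_of_layerRankGEAt_of_le
    (hWu : thm16_charIdeal_dvd_multiplicative_of_reducible)
    (h310 : prop310_selmerCorank_mod_two_eq_lambdaInvariant)
    (hGZK : rank_eq_analyticRank_of_analyticRank_le_one)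
    (hpar : nonempty_modularParametrizationData) (hp2 : p ≠ 2)
    (hmult : W.HasMultiplicativeReductionAtPrime p) (hred : ¬ W.HasIrreducibleModPGaloisRep p)
    (hr : W.analyticRank ≤ 1) {m' k m : ℕ} (hcert : UnitCoeffAt W p m') (hm : LayerRankGEAt W p k m)
    (hle : m' ≤ m + 1) : X2.MazurMainConjectureAt W p :=
  mazurMainConjectureAt_of_unitCoeffAt_of_algebraicLambdaGE_of_le hWu h310 hGZK hpar hp2 hmult hred hr
    hcert (algebraicLambdaGE_of_layerRankGEAt' (Or.inr hmult) hm) hle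

/-! ## §2. END-TO-END at a type-A split étale end: one unit coefficient, `v_p(#E(ℚ)_tors)`, `#S` -/

section EtaleEnd

/-- **The per-pair main-conjecture certificate at a type-A SPLIT ÉTALE END, in the kernel.** `W₀/ℚ`
globally minimal, `p` odd of multiplicative reduction with `p ∣ #E(ℚ)_tors` (hence split and `E[p]`
reducible: the étale end of a type-A class), `S` a finite set of places `v ∤ p` with `p ∣ c_v(W₀)`,
ONE unit-coefficient certificate `UnitCoeffAt W₀ p m` (the coefficient of index `m + 1` of
`ϖ·L_p(W₀,T)` is a `p`-adic unit), and the integer inequality `m + 2·v_p(#E(ℚ)_tors) ≤ #S + 1`. Then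
`X2.MazurMainConjectureAt W₀ p`. Proof: `μ_an = 0` and `λ_an ≤ m + 1` (this seat's certificate
bridge), `λ(X(W₀/ℚ_∞)) ≥ m` (lam-b p480562 with `μ_an ≤ 0`), route T. Named print: `hWu`, `hPT`,
`h415`, `hpar`. [cite: GreenbergLNM1716, §5 pp. 114–118 and Cor. 5.6 (p. 136)]
[cite: Wuthrich2014, Thm. 16 (p. 397)] -/
theorem X2.mazurMainConjectureAt_of_unitCoeffAt_of_dvd_torsionOrder_of_dvd_localTamagawaNumber
    (hodd : p ≠ 2) (hPT : poitouTate_selmerStructure_duality ℚ)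
    (h415 : prop415ii_noFiniteSubmodule_of_ordinary_or_multiplicative)
    (hWu : thm16_charIdeal_dvd_multiplicative_of_reducible)
    (hpar : nonempty_modularParametrizationData)
    (hmult : W.HasMultiplicativeReductionAtPrime p) (htors : p ∣ W.torsionOrder)
    (S : Finset (HeightOneSpectrum (𝓞 ℚ))) (hSp : ∀ v ∈ S, ((p : ℕ) : 𝓞 ℚ) ∉ v.asIdeal)
    (hcv : ∀ v ∈ S,
      p ∣ (W.baseChange (v.adicCompletion ℚ)).localTamagawaNumber (v.adicCompletionIntegers ℚ))
    {m : ℕ} (hcert : UnitCoeffAt W p m)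
    (hb : m + 2 * (W.torsionOrder).factorization p ≤ S.card + 1) :
    X2.MazurMainConjectureAt W p := by
  have hμ : X2.AnalyticMuLE W p 0 :=
    (analyticMuLE_zero_and_exists_analyticLambdaEq_of_unitCoeffAt hcert).1
  have halg : AlgebraicLambdaGE W p (m - 0) :=
    X2.algebraicLambdaGE_of_dvd_torsionOrder_of_dvd_localTamagawaNumber hodd hPT h415 hWu hpar hmult
      htors S hSp hcv hμ hb
  exact mazurMainConjectureAt_of_unitCoeffAt_of_algebraicLambdaGE hWu hodd hmult
    (not_hasIrreducibleModPGaloisRep_of_dvd_torsionOrder W p htors) hcert halg le_rfl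

/-- **Slack form of the per-pair certificate**: `m + 2·v_p(#E(ℚ)_tors) ≤ #S + 2` suffices in analytic
rank `≤ 1`, granted Prop. 3.10 (`h310`) and Gross–Zagier–Kolyvagin (`hGZK`) (one Tamagawa witness
fewer; lam-a g2's parity slack). [cite: GreenbergLNM1716, Prop. 3.10 and Cor. 5.6 (p. 136)]
[cite: Wuthrich2014, Thm. 16 (p. 397)] -/
theorem X2.mazurMainConjectureAt_of_unitCoeffAt_of_dvd_torsionOrder_of_dvd_localTamagawaNumber_slack
    (hodd : p ≠ 2) (hPT : poitouTate_selmerStructure_duality ℚ)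
    (h415 : prop415ii_noFiniteSubmodule_of_ordinary_or_multiplicative)
    (hWu : thm16_charIdeal_dvd_multiplicative_of_reducible)
    (h310 : prop310_selmerCorank_mod_two_eq_lambdaInvariant)
    (hGZK : rank_eq_analyticRank_of_analyticRank_le_one)
    (hpar : nonempty_modularParametrizationData)
    (hmult : W.HasMultiplicativeReductionAtPrime p) (htors : p ∣ W.torsionOrder)
    (hr : W.analyticRank ≤ 1)
    (S : Finset (HeightOneSpectrum (𝓞 ℚ))) (hSp : ∀ v ∈ S, ((p : ℕ) : 𝓞 ℚ) ∉ v.asIdeal)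
    (hcv : ∀ v ∈ S,
      p ∣ (W.baseChange (v.adicCompletion ℚ)).localTamagawaNumber (v.adicCompletionIntegers ℚ))
    {m : ℕ} (hcert : UnitCoeffAt W p m)
    (hb : m + 2 * (W.torsionOrder).factorization p ≤ S.card + 2) :
    X2.MazurMainConjectureAt W p := by
  have hμ : X2.AnalyticMuLE W p 0 :=
    (analyticMuLE_zero_and_exists_analyticLambdaEq_of_unitCoeffAt hcert).1
  rcases Nat.eq_zero_or_pos m with rfl | hmpos
  · -- `m = 0`: the registered form already closes with the empty budget `k = 0`
    exact mazurMainConjectureAt_of_unitCoeffAt_of_algebraicLambdaGE hWu hodd hmult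
      (not_hasIrreducibleModPGaloisRep_of_dvd_torsionOrder W p htors) hcert
      (algebraicLambdaGE_zero W p) le_rfl
  · have hb' : (m - 1) + 2 * (W.torsionOrder).factorization p ≤ S.card + 1 := by omega
    have halg : AlgebraicLambdaGE W p (m - 1 - 0) :=
      X2.algebraicLambdaGE_of_dvd_torsionOrder_of_dvd_localTamagawaNumber hodd hPT h415 hWu hpar hmult
        htors S hSp hcv hμ hb'
    exact mazurMainConjectureAt_of_unitCoeffAt_of_algebraicLambdaGE_of_le hWu h310 hGZK hpar hodd hmult
      (not_hasIrreducibleModPGaloisRep_of_dvd_torsionOrder W p htors) hr hcert halg (by omega)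

/-- **Mazur's main conjecture at EVERY member of the X2b class of a certified étale end** (the ASCEND
step of `MazurMCOnCellB_of`): `W` on sub-cell X2b (`X2.CellB W p`: `r_an = 0`, `p` odd multiplicative,
`E[p]` reducible, ¬GVPar), `W ∼ W₀` with the §2 certificate data AT `W₀` ⇒ `X2.MazurMainConjectureAt W p`
(`X2.mazurMainConjectureAt_of_isIsogenous` with the `PublishedInputs` conjuncts Stein–Wuthrich / GZK /
modularity / Cassels / Greenberg–Stevens). [cite: Wuthrich2014, Thm. 16 and Lemma 17 (p. 397)]
[cite: GreenbergLNM1716, Cor. 5.6 (p. 136)] -/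
theorem X2.cellB_mazurMainConjectureAt_of_isIsogenous_etaleEnd_certificate
    (hodd : p ≠ 2) (hPT : poitouTate_selmerStructure_duality ℚ)
    (h415 : prop415ii_noFiniteSubmodule_of_ordinary_or_multiplicative)
    (hWu : thm16_charIdeal_dvd_multiplicative_of_reducible)
    (hJs : thm61_splitMultiplicative) (hJn : thm61_nonsplitMultiplicative)
    (hHs : exists_isSplitMultCanonical) (hHn : exists_isMultCanonical)
    (hGZK : rank_eq_analyticRank_of_analyticRank_le_one) (hnf : exists_isNewformOf)
    (hpar : nonempty_modularParametrizationData) (hCassels : bsdRHS_eq_of_isIsogenous)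
    (hGS : ∀ (W : WeierstrassCurve ℚ) [W.IsElliptic] [W.IsGloballyMinimal] (p : ℕ) [Fact p.Prime],
      greenberg_stevens (W := W) (p := p))
    (hc : X2.CellB W p) {W₀ : WeierstrassCurve ℚ} [W₀.IsElliptic] [W₀.IsGloballyMinimal]
    (hiso : IsIsogenous W W₀) (htors : p ∣ W₀.torsionOrder)
    (S : Finset (HeightOneSpectrum (𝓞 ℚ))) (hSp : ∀ v ∈ S, ((p : ℕ) : 𝓞 ℚ) ∉ v.asIdeal)
    (hcv : ∀ v ∈ S,
      p ∣ (W₀.baseChange (v.adicCompletion ℚ)).localTamagawaNumber (v.adicCompletionIntegers ℚ))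
    {m : ℕ} (hcert : UnitCoeffAt W₀ p m)
    (hb : m + 2 * (W₀.torsionOrder).factorization p ≤ S.card + 1) :
    X2.MazurMainConjectureAt W p := by
  have hmult : W.HasMultiplicativeReductionAtPrime p := hc.2.1.2.2
  have hmult₀ : W₀.HasMultiplicativeReductionAtPrime p :=
    X2.IsogenyQuotientLine.hasMultiplicativeReductionAtPrime_of_isIsogenous hiso hmult
  have hr₀ : W₀.analyticRank = 0 := by
    rw [← analyticRank_eq_of_isIsogenous' hiso]; exact hc.1
  have hMC₀ : X2.MazurMainConjectureAt W₀ p :=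
    X2.mazurMainConjectureAt_of_unitCoeffAt_of_dvd_torsionOrder_of_dvd_localTamagawaNumber hodd hPT h415
      hWu hpar hmult₀ htors S hSp hcv hcert hb
  exact X2.mazurMainConjectureAt_of_isIsogenous hWu hJs hJn hHs hHn hGZK hnf hpar hCassels hGS
    hiso.symm_of_charZero p hodd hmult₀ (not_hasIrreducibleModPGaloisRep_of_dvd_torsionOrder W₀ p htors)
    hr₀ hMC₀

end EtaleEnd

/-! ## §3. The δ = 0 roads (no rational `p`-torsion at the member): layer 0 and the tower count -/

section DeltaZero

/-- **END-TO-END on lam-b's δ = 0 road (layer 0)**: `p` odd multiplicative, `E[p]` reducible,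
`p ∤ #E(ℚ)_tors` (e.g. the NON-SPLIT type-A étale ends, `φ ≠ 𝟙` even), `S` places `v ∤ p` with
`p ∣ c_v(W)`, ONE unit-coefficient certificate `UnitCoeffAt W p m` and `m ≤ #S` ⇒
`X2.MazurMainConjectureAt W p` (p469158 `X2.algebraicLambdaGE_of_dvd_localTamagawaNumber` gives
`AlgebraicLambdaGE W p #S` from `μ_an ≤ 0`; route T). Named print: `hWu`, `hPT`, `h415`, `hpar`.
[cite: GreenbergLNM1716, §5 pp. 114–118 and Cor. 5.6 (p. 136)] [cite: Wuthrich2014, Thm. 16 (p. 397)] -/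
theorem X2.mazurMainConjectureAt_of_unitCoeffAt_of_dvd_localTamagawaNumber (hp2 : p ≠ 2)
    (hPT : poitouTate_selmerStructure_duality ℚ)
    (h415 : prop415ii_noFiniteSubmodule_of_ordinary_or_multiplicative)
    (hWu : thm16_charIdeal_dvd_multiplicative_of_reducible)
    (hpar : nonempty_modularParametrizationData)
    (hmult : W.HasMultiplicativeReductionAtPrime p) (hred : ¬ W.HasIrreducibleModPGaloisRep p)
    (htors : ¬ p ∣ W.torsionOrder) (S : Finset (HeightOneSpectrum (𝓞 ℚ)))
    (hSp : ∀ v ∈ S, ((p : ℕ) : 𝓞 ℚ) ∉ v.asIdeal)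
    (hcv : ∀ v ∈ S,
      p ∣ (W.baseChange (v.adicCompletion ℚ)).localTamagawaNumber (v.adicCompletionIntegers ℚ))
    {m : ℕ} (hcert : UnitCoeffAt W p m) (hmS : m ≤ S.card) : X2.MazurMainConjectureAt W p := by
  have hμ : X2.AnalyticMuLE W p 0 :=
    (analyticMuLE_zero_and_exists_analyticLambdaEq_of_unitCoeffAt hcert).1
  have halg : AlgebraicLambdaGE W p (S.card - 0) :=
    EisensteinPrimesAlgebraicLambdaGEBudget.X2.algebraicLambdaGE_of_dvd_localTamagawaNumber hp2 hPT
      h415 hWu hpar hmult hred htors S hSp hcv hμ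
  rw [Nat.sub_zero] at halg
  exact mazurMainConjectureAt_of_unitCoeffAt_of_algebraicLambdaGE hWu hp2 hmult hred hcert halg hmS

/-- **END-TO-END on the δ = 0 TOWER count (lam-b p469158 `X2.algebraicLambdaGE_layer_of_certificates`)**:
same member data with `μ_an = 0` from the certificate, and for each `v ∈ S` a place-count certificate
`v_p(N(v)^{p−1} − 1) = m_v + 1` (`s_v = p^{m_v}` primes above `v` high in the cyclotomic tower),
`p ∣ c_v`, `v` additive or split multiplicative; then `UnitCoeffAt W p m` with
`m ≤ Σ_{v ∈ S} p^{min(n, m_v)}` for some layer `n` ⇒ `X2.MazurMainConjectureAt W p`. Named print: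
Prop. 4.14 (`h414`), Poitou–Tate and the local Euler–Poincaré formula over `ℚ_n` (`hPT`, `hEP`),
Wuthrich Thm. 16, modularity. [cite: GreenbergLNM1716, §5 pp. 114–118, Prop. 4.14 and p. 137]
[cite: Washington1997, §13.1, Prop. 13.2] [cite: Wuthrich2014, Thm. 16 (p. 397)] -/
theorem X2.mazurMainConjectureAt_of_unitCoeffAt_of_layer_certificates (hp2 : p ≠ 2)
    (h414 : prop414_noFiniteSubmodule_of_not_dvd_torsionOrder)
    (hWu : thm16_charIdeal_dvd_multiplicative_of_reducible)
    (hpar : nonempty_modularParametrizationData)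
    (hmult : W.HasMultiplicativeReductionAtPrime p) (hred : ¬ W.HasIrreducibleModPGaloisRep p)
    (htors : ¬ p ∣ W.torsionOrder) (n : ℕ)
    (hPT : ∀ (κ : ZpExtension ℚ p) [NumberField (κ.layer n)], κ.IsCyclotomic →
      poitouTate_selmerStructure_duality (κ.layer n))
    (hEP : ∀ (κ : ZpExtension ℚ p) [NumberField (κ.layer n)], κ.IsCyclotomic →
      ∀ w : HeightOneSpectrum (𝓞 (κ.layer n)),
      Literature.NumberTheory.GaloisRepresentations.localEulerPoincareCharacteristic
        (w.adicCompletion (κ.layer n)))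
    (S : Finset (HeightOneSpectrum (𝓞 ℚ))) (mv : HeightOneSpectrum (𝓞 ℚ) → ℕ)
    (hSp : ∀ v ∈ S, ((p : ℕ) : 𝓞 ℚ) ∉ v.asIdeal)
    (hval : ∀ v ∈ S, padicValNat p (v.residueCard ^ (p - 1) - 1) = mv v + 1)
    (hcv : ∀ v ∈ S,
      p ∣ (W.baseChange (v.adicCompletion ℚ)).localTamagawaNumber (v.adicCompletionIntegers ℚ))
    (hdat : ∀ v ∈ S, W.HasAdditiveReductionAt v ∨ W.HasSplitMultiplicativeReductionAt v)
    {m : ℕ} (hcert : UnitCoeffAt W p m) (hm : m ≤ ∑ v ∈ S, p ^ min n (mv v)) :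
    X2.MazurMainConjectureAt W p := by
  have hμ : X2.AnalyticMuLE W p 0 :=
    (analyticMuLE_zero_and_exists_analyticLambdaEq_of_unitCoeffAt hcert).1
  exact mazurMainConjectureAt_of_unitCoeffAt_of_algebraicLambdaGE hWu hp2 hmult hred hcert
    (EisensteinPrimesAlgebraicLambdaGEBudget.X2.algebraicLambdaGE_layer_of_certificates hp2 h414 hWu hpar
      hmult hred htors n hPT hEP S mv hSp hval hcv hdat hμ) hm

end DeltaZero

end Summit.BirchSwinnertonDyer.BirchSwinnertonDyer.Theorems.EisensteinPrimesX2LambdaCountAtPair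

end
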